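import Summits.QuantumFields.BalabanUV.Beta.FP.FineHessianGluonCore
import Summits.QuantumFields.BalabanUV.Beta.FP.FineHessianTransportTable
import Summits.QuantumFields.BalabanUV.Beta.FP.FineSplitJunctionLedger

/-!
# `BalabanUV.Beta.FP.FineHessianNearLedgerCore` — road «FP» for binder row D1, ROW KER-γ (α2) sub-row α2-b PART 3a = THE (LEDGER) SKELETON, CORE (owner memo
# `KER-GAMMA-ALPHA2.md` §3∕§5, R-FP-34∕35∕36): THE NEAR PIECE OF THE JUNCTION AS A NAMED FINITE LEDGER — with the slice exchange `hslice` (H′1-KER), the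
# MIX split (α2-a PART 2) and the ghost split (α2-c) DISPLAYED, the near difference `(F m − N⁸·PiBF(s′−s))·𝟙[‖s′−s‖∞ ≤ N]` IS the sum of the SEVEN
# GLUON-CORE WORDS of PART 2 (bounded, proved here) + the displayed MIX pieces + the displayed ghost pieces + the normalisation piece; hence
# (ASYMP) at the bi-vertex perfect kernel ⟸ H2V-4 letters ∧ colour ∧ far letter ∧ `hslice` ∧ the two displayed splits ∧ ONE (rem) LEDGER LINE PER NAMED PIECE

HONEST DEPENDENCY (page 1, mandatory): continuum YM on T⁴ ⇐ BetaPertH ∧ nine spine estimates (0/9 proved); BetaPertH ⇐ (D1) ∧ (D4) ∧ CAP+tail;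
G-an2-4 gates asym, D1 and NE2/3/4.  HONEST FRAMING (cell contract, verbatim): «discharging `BetaPertH` makes Bałaban's UV stability UNCONDITIONAL —
a real constructive-QFT result; it is NOT the continuum limit and NOT the Clay problem.»  THIS MODULE DISCHARGES NOTHING of the wall: it is [folklore]
bookkeeping (finite sums of two-point tables under a window indicator; entry bounds of the seven words from `ContactCount.abs_tadpole∕bubble_le_of_entryBound`
and the two-leg twin proved here) and a BY-NAME composition of PART 2 `FineHessianGluonCore.fineHessA_gluonCore`∕`fineHessA_Pker_eq_ff`, PART 0
`FineHessianTransportTable.PiBF_eq_fineHessA`, leaf-01-g11's (E) `FineSplitJunctionLedger.hasym_PiBF_vertex2OfK_of_far_nearPieces` and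
`PerfectPolarizationWard.bdd_Pker`.  EVERY analytic input is a DISPLAYED HYPOTHESIS: `hslice` (the slice exchange at table level, H′1-KER — shared lane,
an2 W-4; NOT proved anywhere yet for the literal), `hmix` (α2-a PART 2), `hgh` (α2-c), the unit constants `(c m, a m)` with `c m²·a m² = (Lc^m)⁸·wg` (N0b-S),
the letters of the slice leg's remainder `R m` and of the slice stencils, and ONE (rem) ledger number per named piece.  No `def`, no `def … : Prop`, nothing
cited, 0 sorry; 0∕4 row-D1 binders; NOT hsplit (its `hslice`∕`hmix`∕`hgh` members are hypotheses), NOT any ledger line, NOT (ASYMP) for the literal, NOT D1,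
NOT BetaPertH, NOT continuum, NOT Clay.  «not in print; our bookkeeping».  (The unit constants `(c m, a m, b m)` and the bubble weight `κ m` with
`(Lc^m)⁸·wg = c m·b m = κ m·(c m)²·(a m)²` are N0b-S∕W data in the sense of an3's located answer Q2 — NOT chosen here.)

ABSOLUTE RULE (cell charter, verbatim): «No internally-minted statement may enter as a cited fact. Every hypothesis is either kernel-proved in this package or a
verbatim quotation of a PUBLISHED theorem with page reference. The manuscript(s) under audit are NOT citable for their own disputed steps — they are the thing
under adjudication; programme-internal (2001/route/tribunal) claims are never citable.»

WHAT.  §1 [folklore] `abs_ite_le` , `bdd_blk`, **`abs_biBubble_le_of_entryBound`** (two bounded legs); §2 [folklore] **`gluonCore_weighted`** — the WEIGHTED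
gluon core `(½·tadpole (c•P+R) Wf − ½·κ·bubble (c•P+R) S S) − ρ·fineHessA P V W = 4 R-words + 3 defect-words` under the TWO unit relations `ρ = c·b` (tadpole),
`ρ = κ·c²·a²` (bubble) — the bubble weight `κ` and the bi-table unit `b` DISPLAYED (an3's located answer Q2: in the literal's `ad(t_c)`-stripping convention the
bubble's colour trace is a RELATIVE weight between tadpole and bubble, `StepJetData` (D-κ); `κ = 1`, `b = c·a²` is PART 2's plain `fineHessA_gluonCore`),
**`near_gluonCore_eq_seven`** (the same on the window, the seven words as two-point tables) and **`bounded_seven`** (each word entry-bounded, uniformly in the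
bond pair); §3 [folklore] **`nearSplit_of_slice`** — the near difference from `hslice` + `hmix` + `hgh` + the comparison identity `Kc(s′−s) = wg·fineHessA P V W −
wgh·G0` + the two unit relations, as ONE finite sum over `Fin 7 ⊕ ιM ⊕ ιG ⊕ Unit`.  (§4, the composed END `hasym_PiBF_vertex2OfK_of_sliceLedger` at the road's objects,
is the sibling module `FineHessianNearLedger` — split for the 400-line rule.)
Provenance: road FP OWNER b2b-balaban-beta-d1-p3 gen 10 (prover-b2b-balaban-beta-d1-p3-g10-0), 2026-08-21, sub-row α2-b part 3a ∕ (LEDGER) skeleton core.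
-/

noncomputable section

namespace Summit.QuantumFields.BalabanUV.Beta.FP.FineHessianNearLedgerCore

open Finset
open scoped BigOperators
open Literature.MathematicalPhysics.QuantumFieldTheory.Balaban1983to89
open Literature.MathematicalPhysics.QuantumFieldTheory.Balaban1983to89.Beta
open Literature.MathematicalPhysics.QuantumFieldTheory.Balaban1983to89.Beta.BubbleTransfer (c4)
open Literature.MathematicalPhysics.QuantumFieldTheory.Balaban1983to89.B12Normalization (stepBal)
open B12Sec2to5 (l1 l1_nonneg)
open PolarizationSign (reflSign)
open ExpKernelCalculus (Site MKer BiLoc comp shiftK tr tadpole bubble Zl Zl_nonneg)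
open KernelWard (Bdd divV divW)
open KernelReflection (LegMap refK bondRefl tadpole_smul bubble_smul_left bubble_smul_right)
open StepJetData (biLoc_smul)
open OneStepResolventKernel (Fib LocStencil)
open OneStepKernelFamily (colH)
open DyadicShell (Pt supNorm)
open LeadingCoefficient (kappaBal)
open AxialProjector (coProj)
open AxialDressing (axDressK)
open SecondOrderResponse (vertex2OfK)
open Summit.QuantumFields.BalabanUV.Beta.GAN24.CombesThomas (sfStep smStep)
open Summit.QuantumFields.BalabanUV.Beta.D1BFx.MomentTransferPeriodicEntry (EKer₂ dressedEntryP)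
open Summit.QuantumFields.BalabanUV.Beta.D1BFx.ReducedKernelSandwichLeg (fineHessA fineHessA_apply)
open Summit.QuantumFields.BalabanUV.Beta.D1BFx.DressedTablesLeg (tadpoleTableA_apply bubbleTableA_apply)
open Summit.QuantumFields.BalabanUV.Beta.D1BFx.PackedKernelSplit (inj blk biLoc_blk)
open Summit.QuantumFields.BalabanUV.Beta.D1BFx.ContactCount (abs_comp_le_of_entryBound abs_comp_le_of_rightLoc abs_tr_le_of_rightLoc
  abs_tadpole_le_of_entryBound abs_bubble_le_of_entryBound)
open Summit.QuantumFields.BalabanUV.Beta.FP.PerfectObjectsT (KPerf TPerfOf)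
open Summit.QuantumFields.BalabanUV.Beta.FP.WilsonCubicGerm (cubicGermOf)
open Summit.QuantumFields.BalabanUV.Beta.FP.GhostCubicGerm (cubicGermOfSc)
open Summit.QuantumFields.BalabanUV.Beta.FP.BubbleGermValue (bfGerm ghostGerm)
open Summit.QuantumFields.BalabanUV.Beta.FP.PerfectPolarization (Pker G0ker PiBF)
open Summit.QuantumFields.BalabanUV.Beta.FP.FineHessianGluonCore (fineHessA_gluonCore fineHessA_Pker_eq_ff bdd_smul)
open Summit.QuantumFields.BalabanUV.Beta.FP.FineHessianTransportTable (PiBF_eq_fineHessA)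
open Summit.QuantumFields.BalabanUV.Beta.FP.FineSplitJunctionLedger (hasym_PiBF_vertex2OfK_of_far_nearPieces)

/-! ## §1 Bricks -/

section Bricks

variable {D : ℕ} {F : Type*} [Fintype F]

/-- [folklore] a windowed entry is bounded by the entry. -/
theorem abs_ite_le (p : Prop) [Decidable p] (x : ℝ) : |(if p then x else 0)| ≤ |x| := by
  split_ifs
  · exact le_rfl
  · rw [abs_zero]; exact abs_nonneg _

omit [Fintype F] in
/-- [folklore] a block of a bounded packed kernel is bounded. -/
theorem bdd_blk {K : MKer D (F ⊕ F)} {B : ℝ} (h : Bdd K B) (i j : Bool) : Bdd (blk K i j) B :=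
  fun x z a b => h x z (inj i a) (inj j b)

/-- [folklore] **TWO-LEG BUBBLE UNDER ENTRY BOUNDS**: `|A| ≤ CA`, `|B| ≤ CB`, `V` bi-localised at `(p,p)`, `W` at `(q,q)` (rate `δ > 0`) ⟹
`|tr((A∘V)∘(B∘W))| ≤ |F|·(|F|·(|F|·CA·Cv·Zl δ)·(|F|·CB·Cw·Zl δ)·Zl δ)·Zl δ` — uniformly in `p, q`. -/
theorem abs_biBubble_le_of_entryBound {A B V W : MKer D F} {CA CB Cv Cw δ : ℝ} (hCA : 0 ≤ CA) (hA : ∀ x y a b, |A x y a b| ≤ CA)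
    (hCB : 0 ≤ CB) (hB : ∀ x y a b, |B x y a b| ≤ CB) {p q : Site D} (hV : BiLoc V p p Cv δ) (hW : BiLoc W q q Cw δ) (hδ : 0 < δ) :
    |tr (comp (comp A V) (comp B W))| ≤
      (Fintype.card F : ℝ) *
          ((Fintype.card F : ℝ) * (((Fintype.card F : ℝ) * (CA * Cv) * Zl D δ) * ((Fintype.card F : ℝ) * (CB * Cw) * Zl D δ)) *
            Zl D δ) * Zl D δ := by
  have hP : ∀ x y a b, |comp A V x y a b| ≤ ((Fintype.card F : ℝ) * (CA * Cv) * Zl D δ) * Real.exp (-δ * l1 (y - p)) :=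
    fun x y a b => abs_comp_le_of_entryBound hCA hA hV hδ x y a b
  have hQ : ∀ y z a b, |comp B W y z a b| ≤ ((Fintype.card F : ℝ) * (CB * Cw) * Zl D δ) * Real.exp (-δ * l1 (z - q)) :=
    fun y z a b => abs_comp_le_of_entryBound hCB hB hW hδ y z a b
  exact abs_tr_le_of_rightLoc (q := q) (fun x z a b => abs_comp_le_of_rightLoc hP hQ hδ x z a b) hδ

end Bricks

/-! ## §2 The weighted gluon core on the window: the seven words and their bounds -/

section Seven

variable {F : Type*} [Fintype F]

/-- [folklore] **THE WEIGHTED GLUON CORE** (`D = 4`; bubble weight `κ` DISPLAYED — an3's located answer Q2∕(D-κ): in the literal's stripping convention the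
bubble's colour trace rides as a relative weight between the tadpole word and the bubble word, so the gluon table is `½·tadpole Γ Wf − ½·κ·bubble Γ S S`, `κ`
a real number the road does not choose; `κ = 1` is `fineHessA Γ S Wf`).  For BOUNDED `P`, `R`, bi-localised `S, V, Wf, W` (common rate), units `c` (leg), `a`
(stencils), `b` (bi-tables) and a comparison factor `ρ` with the TWO unit relations `ρ = c·b` (tadpole) and `ρ = κ·c²·a²` (bubble):
`( ½·tadpole (c•P + R) Wf − ½·κ·bubble (c•P + R) S S ) − ρ·fineHessA P V W = 4 R-WORDS + 3 DEFECT-WORDS` (`D := S − a•V`, `E := Wf − b•W`; the bubble-type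
words carry `κ`), by PART 1's leg additivity and PART 2's vertex additivity∕scaling BY NAME. -/
theorem gluonCore_weighted {P R : MKer 4 F} {CP CR : ℝ} (hP : Bdd P CP) (hR : Bdd R CR) (c a b κ ρ : ℝ) (hρt : ρ = c * b) (hρb : ρ = κ * (c ^ 2 * a ^ 2))
    {S V : Fin 4 → Site 4 → MKer 4 F} {Cs Cv δ : ℝ} (hS : ∀ κ u, BiLoc (S κ u) u u Cs δ) (hV : ∀ κ u, BiLoc (V κ u) u u Cv δ)
    {Wf W : Fin 4 → Site 4 → Fin 4 → Site 4 → MKer 4 F} {C2 Cw : ℝ}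
    (hWf : ∀ κ u l u', BiLoc (Wf κ u l u') u u' C2 δ) (hW : ∀ κ u l u', BiLoc (W κ u l u') u u' Cw δ) (hδ : 0 < δ)
    (κ' l' : Fin 4) (u u' : Site 4) :
    ((1 / 2 : ℝ) * tadpole (c • P + R) (Wf κ' u l' u') - (1 / 2 : ℝ) * κ * bubble (c • P + R) (S κ' u) (S l' u'))
        - ρ * fineHessA P V W κ' l' u u' =
      ((1 / 2 : ℝ) * tadpole R (Wf κ' u l' u')
          - (1 / 2 : ℝ) * κ * (tr (comp (comp (c • P) (S κ' u)) (comp R (S l' u'))) + tr (comp (comp R (S κ' u)) (comp (c • P) (S l' u')))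
              + bubble R (S κ' u) (S l' u')))
      + ((1 / 2 : ℝ) * tadpole (c • P) (Wf κ' u l' u' - b • W κ' u l' u')
          - (1 / 2 : ℝ) * κ * (bubble (c • P) (S κ' u - a • V κ' u) (S l' u') + bubble (c • P) (a • V κ' u) (S l' u' - a • V l' u'))) := by
  have hcP : Bdd (c • P) (|c| * CP) := bdd_smul hP c
  have haV : ∀ κ v, BiLoc (a • V κ v) v v (|a| * Cv) δ := fun κ v => biLoc_smul (hV κ v) a
  have hbW : ∀ κ v l v', BiLoc (b • W κ v l v') v v' (|b| * Cw) δ := fun κ v l v' => biLoc_smul (hW κ v l v') b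
  -- leg additivity (PART 1)
  have e1 := FineHessianLegSplit.tadpole_add_leg_bdd hcP hR (hWf κ' u l' u') hδ
  have e2 := FineHessianLegSplit.bubble_add_leg_bdd hcP hR (hS κ' u) (hS l' u') hδ
  -- vertex additivity and scaling (PART 2)
  have e3 := FineHessianGluonCore.tadpole_sub_right_bdd hcP (hWf κ' u l' u') (hbW κ' u l' u') hδ
  have e4 : tadpole (c • P) (b • W κ' u l' u') = c * b * tadpole P (W κ' u l' u') := by
    rw [tadpole_smul, FineHessianGluonCore.tadpole_smul_leg]; ring
  have e5 := FineHessianGluonCore.bubble_sub_left_bdd hcP (hS κ' u) (haV κ' u) (hS l' u') hδ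
  have e6 := FineHessianGluonCore.bubble_sub_right_bdd hcP (haV κ' u) (hS l' u') (haV l' u') hδ
  have e7 : bubble (c • P) (a • V κ' u) (a • V l' u') = c ^ 2 * a ^ 2 * bubble P (V κ' u) (V l' u') := by
    rw [bubble_smul_left, bubble_smul_right, FineHessianGluonCore.bubble_smul_leg]; ring
  rw [fineHessA_apply, tadpoleTableA_apply, bubbleTableA_apply, e1, e2]
  unfold ExpKernelCalculus.bubble at e5 e6 e7 ⊢
  rw [hρt] at *
  linear_combination (-(1 / 2 : ℝ)) * e3 + (1 / 2 : ℝ) * κ * e5 + (1 / 2 : ℝ) * κ * e6 + (1 / 2 : ℝ) * e4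
    - (1 / 2 : ℝ) * κ * e7 + (1 / 2 : ℝ) * tr (comp (comp P (V κ' u)) (comp P (V l' u'))) * hρb

/-- [folklore] **THE NEAR WEIGHTED GLUON CORE IS THE SUM OF THE SEVEN WORDS, WINDOWED** (threshold `Nw`): at every `(κ′, l′, u, u′)`,
`𝟙·( (½·tadpole (c•P + R) Wf − ½·κ·bubble (c•P + R) S S) − ρ·fineHessA P V W )` = the sum of the seven windowed words. -/
theorem near_gluonCore_eq_seven {P R : MKer 4 F} {CP CR : ℝ} (hP : Bdd P CP) (hR : Bdd R CR) (c a b κ ρ : ℝ) (hρt : ρ = c * b)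
    (hρb : ρ = κ * (c ^ 2 * a ^ 2)) (Nw : ℕ)
    {S V : Fin 4 → Site 4 → MKer 4 F} {Cs Cv δ : ℝ} (hS : ∀ κ u, BiLoc (S κ u) u u Cs δ) (hV : ∀ κ u, BiLoc (V κ u) u u Cv δ)
    {Wf W : Fin 4 → Site 4 → Fin 4 → Site 4 → MKer 4 F} {C2 Cw : ℝ}
    (hWf : ∀ κ u l u', BiLoc (Wf κ u l u') u u' C2 δ) (hW : ∀ κ u l u', BiLoc (W κ u l u') u u' Cw δ) (hδ : 0 < δ)
    (κ' l' : Fin 4) (u u' : Pt) :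
    (if supNorm (u' - u) ≤ Nw then
        ((1 / 2 : ℝ) * tadpole (c • P + R) (Wf κ' u l' u') - (1 / 2 : ℝ) * κ * bubble (c • P + R) (S κ' u) (S l' u'))
          - ρ * fineHessA P V W κ' l' u u' else 0)
      = (if supNorm (u' - u) ≤ Nw then (1 / 2 : ℝ) * tadpole R (Wf κ' u l' u') else 0)
        + (if supNorm (u' - u) ≤ Nw then -((1 / 2 : ℝ) * κ) * tr (comp (comp (c • P) (S κ' u)) (comp R (S l' u'))) else 0)
        + (if supNorm (u' - u) ≤ Nw then -((1 / 2 : ℝ) * κ) * tr (comp (comp R (S κ' u)) (comp (c • P) (S l' u'))) else 0)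
        + (if supNorm (u' - u) ≤ Nw then -((1 / 2 : ℝ) * κ) * bubble R (S κ' u) (S l' u') else 0)
        + (if supNorm (u' - u) ≤ Nw then (1 / 2 : ℝ) * tadpole (c • P) (Wf κ' u l' u' - b • W κ' u l' u') else 0)
        + (if supNorm (u' - u) ≤ Nw then -((1 / 2 : ℝ) * κ) * bubble (c • P) (S κ' u - a • V κ' u) (S l' u') else 0)
        + (if supNorm (u' - u) ≤ Nw then -((1 / 2 : ℝ) * κ) * bubble (c • P) (a • V κ' u) (S l' u' - a • V l' u') else 0) := by
  by_cases h : supNorm (u' - u) ≤ Nw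
  · simp only [if_pos h]
    rw [gluonCore_weighted hP hR c a b κ ρ hρt hρb hS hV hWf hW hδ κ' l' u u']
    ring
  · simp only [if_neg h]; ring

/-- [folklore] **THE SEVEN WORDS ARE ENTRY-BOUNDED, UNIFORMLY IN THE BOND PAIR** — one constant for all seven (sum of the seven `ContactCount` constants, the
bubble-type ones weighted by `|κ|`). -/
theorem bounded_seven {P R : MKer 4 F} {CP CR : ℝ} (hP : Bdd P CP) (hR : Bdd R CR) (c a b κ : ℝ) (Nw : ℕ)
    {S V : Fin 4 → Site 4 → MKer 4 F} {Cs Cv δ : ℝ} (hS : ∀ κ u, BiLoc (S κ u) u u Cs δ) (hV : ∀ κ u, BiLoc (V κ u) u u Cv δ)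
    {Wf W : Fin 4 → Site 4 → Fin 4 → Site 4 → MKer 4 F} {C2 Cw : ℝ}
    (hWf : ∀ κ u l u', BiLoc (Wf κ u l u') u u' C2 δ) (hW : ∀ κ u l u', BiLoc (W κ u l u') u u' Cw δ) (hδ : 0 < δ)
    (κ' l' : Fin 4) :
    ∃ A : ℝ,
      (∀ u u' : Pt, |(if supNorm (u' - u) ≤ Nw then (1 / 2 : ℝ) * tadpole R (Wf κ' u l' u') else 0)| ≤ A) ∧
      (∀ u u' : Pt, |(if supNorm (u' - u) ≤ Nw then -((1 / 2 : ℝ) * κ) * tr (comp (comp (c • P) (S κ' u)) (comp R (S l' u'))) else 0)| ≤ A) ∧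
      (∀ u u' : Pt, |(if supNorm (u' - u) ≤ Nw then -((1 / 2 : ℝ) * κ) * tr (comp (comp R (S κ' u)) (comp (c • P) (S l' u'))) else 0)| ≤ A) ∧
      (∀ u u' : Pt, |(if supNorm (u' - u) ≤ Nw then -((1 / 2 : ℝ) * κ) * bubble R (S κ' u) (S l' u') else 0)| ≤ A) ∧
      (∀ u u' : Pt, |(if supNorm (u' - u) ≤ Nw then (1 / 2 : ℝ) * tadpole (c • P) (Wf κ' u l' u' - b • W κ' u l' u') else 0)| ≤ A) ∧
      (∀ u u' : Pt, |(if supNorm (u' - u) ≤ Nw then -((1 / 2 : ℝ) * κ) * bubble (c • P) (S κ' u - a • V κ' u) (S l' u') else 0)| ≤ A) ∧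
      (∀ u u' : Pt, |(if supNorm (u' - u) ≤ Nw then -((1 / 2 : ℝ) * κ) * bubble (c • P) (a • V κ' u) (S l' u' - a • V l' u') else 0)| ≤ A) := by
  classical
  rcases isEmpty_or_nonempty F with hF | ⟨⟨a₀⟩⟩
  · refine ⟨0, ?_, ?_, ?_, ?_, ?_, ?_, ?_⟩ <;> intro u u' <;>
      simp [ExpKernelCalculus.tadpole, ExpKernelCalculus.bubble, ExpKernelCalculus.tr]
  have hCP : 0 ≤ CP := (abs_nonneg _).trans (hP 0 0 a₀ a₀)
  have hCR : 0 ≤ CR := (abs_nonneg _).trans (hR 0 0 a₀ a₀)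
  have hcP : Bdd (c • P) (|c| * CP) := bdd_smul hP c
  have hcCP : 0 ≤ |c| * CP := mul_nonneg (abs_nonneg c) hCP
  have haV : ∀ κ v, BiLoc (a • V κ v) v v (|a| * Cv) δ := fun κ v => biLoc_smul (hV κ v) a
  have hD : ∀ κ v, BiLoc (S κ v - a • V κ v) v v (Cs + |a| * Cv) δ := fun κ v => KernelWard.biLoc_sub (hS κ v) (haV κ v)
  have hE : ∀ κ v l v', BiLoc (Wf κ v l v' - b • W κ v l v') v v' (C2 + |b| * Cw) δ :=
    fun κ v l v' => KernelWard.biLoc_sub (hWf κ v l v') (biLoc_smul (hW κ v l v') b)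
  have hk : 0 ≤ (1 / 2 : ℝ) * |κ| := by positivity
  -- the seven ContactCount constants
  set n : ℝ := (Fintype.card F : ℝ) with hn
  set A1 : ℝ := (1 / 2 : ℝ) * (n * (n * (CR * C2) * Zl 4 δ) * Zl 4 δ)
  set A2 : ℝ := (1 / 2 : ℝ) * |κ| * (n * (n * ((n * (|c| * CP * Cs) * Zl 4 δ) * (n * (CR * Cs) * Zl 4 δ)) * Zl 4 δ) * Zl 4 δ)
  set A3 : ℝ := (1 / 2 : ℝ) * |κ| * (n * (n * ((n * (CR * Cs) * Zl 4 δ) * (n * (|c| * CP * Cs) * Zl 4 δ)) * Zl 4 δ) * Zl 4 δ)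
  set A4 : ℝ := (1 / 2 : ℝ) * |κ| * (n * (n * ((n * (CR * Cs) * Zl 4 δ) * (n * (CR * Cs) * Zl 4 δ)) * Zl 4 δ) * Zl 4 δ)
  set A5 : ℝ := (1 / 2 : ℝ) * (n * (n * (|c| * CP * (C2 + |b| * Cw)) * Zl 4 δ) * Zl 4 δ)
  set A6 : ℝ := (1 / 2 : ℝ) * |κ| * (n * (n * ((n * (|c| * CP * (Cs + |a| * Cv)) * Zl 4 δ) * (n * (|c| * CP * Cs) * Zl 4 δ)) * Zl 4 δ) * Zl 4 δ)
  set A7 : ℝ := (1 / 2 : ℝ) * |κ| * (n * (n * ((n * (|c| * CP * (|a| * Cv)) * Zl 4 δ) * (n * (|c| * CP * (Cs + |a| * Cv)) * Zl 4 δ)) * Zl 4 δ) * Zl 4 δ)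
  have habsk : |-((1 / 2 : ℝ) * κ)| = (1 / 2 : ℝ) * |κ| := by
    rw [abs_neg, abs_mul, abs_of_pos (by norm_num : (0 : ℝ) < 1 / 2)]
  have h1 : ∀ u u' : Pt, |(1 / 2 : ℝ) * tadpole R (Wf κ' u l' u')| ≤ A1 := fun u u' => by
    rw [abs_mul, abs_of_pos (by norm_num : (0 : ℝ) < 1 / 2)]
    exact mul_le_mul_of_nonneg_left (abs_tadpole_le_of_entryBound hCR hR (hWf κ' u l' u') hδ) (by norm_num)
  have h2 : ∀ u u' : Pt, |-((1 / 2 : ℝ) * κ) * tr (comp (comp (c • P) (S κ' u)) (comp R (S l' u')))| ≤ A2 := fun u u' => by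
    rw [abs_mul, habsk]
    exact mul_le_mul_of_nonneg_left (abs_biBubble_le_of_entryBound hcCP hcP hCR hR (hS κ' u) (hS l' u') hδ) hk
  have h3 : ∀ u u' : Pt, |-((1 / 2 : ℝ) * κ) * tr (comp (comp R (S κ' u)) (comp (c • P) (S l' u')))| ≤ A3 := fun u u' => by
    rw [abs_mul, habsk]
    exact mul_le_mul_of_nonneg_left (abs_biBubble_le_of_entryBound hCR hR hcCP hcP (hS κ' u) (hS l' u') hδ) hk
  have h4 : ∀ u u' : Pt, |-((1 / 2 : ℝ) * κ) * bubble R (S κ' u) (S l' u')| ≤ A4 := fun u u' => by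
    rw [abs_mul, habsk]
    exact mul_le_mul_of_nonneg_left (abs_bubble_le_of_entryBound hCR hR (hS κ' u) (hS l' u') hδ) hk
  have h5 : ∀ u u' : Pt, |(1 / 2 : ℝ) * tadpole (c • P) (Wf κ' u l' u' - b • W κ' u l' u')| ≤ A5 := fun u u' => by
    rw [abs_mul, abs_of_pos (by norm_num : (0 : ℝ) < 1 / 2)]
    exact mul_le_mul_of_nonneg_left (abs_tadpole_le_of_entryBound hcCP hcP (hE κ' u l' u') hδ) (by norm_num)
  have h6 : ∀ u u' : Pt, |-((1 / 2 : ℝ) * κ) * bubble (c • P) (S κ' u - a • V κ' u) (S l' u')| ≤ A6 := fun u u' => by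
    rw [abs_mul, habsk]
    exact mul_le_mul_of_nonneg_left (abs_bubble_le_of_entryBound hcCP hcP (hD κ' u) (hS l' u') hδ) hk
  have h7 : ∀ u u' : Pt, |-((1 / 2 : ℝ) * κ) * bubble (c • P) (a • V κ' u) (S l' u' - a • V l' u')| ≤ A7 := fun u u' => by
    rw [abs_mul, habsk]
    exact mul_le_mul_of_nonneg_left (abs_bubble_le_of_entryBound hcCP hcP (haV κ' u) (hD l' u') hδ) hk
  have hA1 : 0 ≤ A1 := (abs_nonneg _).trans (h1 0 0)
  have hA2 : 0 ≤ A2 := (abs_nonneg _).trans (h2 0 0)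
  have hA3 : 0 ≤ A3 := (abs_nonneg _).trans (h3 0 0)
  have hA4 : 0 ≤ A4 := (abs_nonneg _).trans (h4 0 0)
  have hA5 : 0 ≤ A5 := (abs_nonneg _).trans (h5 0 0)
  have hA6 : 0 ≤ A6 := (abs_nonneg _).trans (h6 0 0)
  have hA7 : 0 ≤ A7 := (abs_nonneg _).trans (h7 0 0)
  refine ⟨A1 + A2 + A3 + A4 + A5 + A6 + A7, ?_, ?_, ?_, ?_, ?_, ?_, ?_⟩ <;> intro u u' <;> refine (abs_ite_le _ _).trans ?_
  · exact (h1 u u').trans (by linarith)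
  · exact (h2 u u').trans (by linarith)
  · exact (h3 u u').trans (by linarith)
  · exact (h4 u u').trans (by linarith)
  · exact (h5 u u').trans (by linarith)
  · exact (h6 u u').trans (by linarith)
  · exact (h7 u u').trans (by linarith)

end Seven

/-! ## §3 The near split from the displayed slice exchange, MIX split and ghost split -/

section NearSplit

variable {F : Type*} [Fintype F]

/-- [folklore] **THE NEAR DIFFERENCE AS ONE FINITE SUM** (`D = 4`, one blocking `Nw`, units `c, a, b`, bubble weight `κ`, weights `wg`, `wgh`, factor `r` with the
two unit relations `r·wg = c·b`, `r·wg = κ·c²·a²`).  DISPLAYED: the slice exchange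
`hslice : F = (½·tadpole (c•P + R) Wsl − ½·κ·bubble (c•P + R) Ssl Ssl) + Fmix + Fgh + FN` (entrywise), the comparison identity
`hPi : Kc c e (s′−s) = wg·fineHessA P V W c e s s′ − wgh·G0 c e s s′`, the MIX split `hmix` of `𝟙·Fmix` over `JM`, the ghost split `hgh` of
`𝟙·(Fgh + r·wgh·G0)` over `JG`.  CONCLUSION: `𝟙·(F − r·Kc(s′−s)) = Σ_{j ∈ J} G j` with `J := univ(Fin 7) ⊕ JM ⊕ JG ⊕ {⋆}` and `G` = the seven words ⊕ the
MIX pieces ⊕ the ghost pieces ⊕ the windowed normalisation table. -/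
theorem nearSplit_of_slice {P R : MKer 4 F} {CP CR : ℝ} (hP : Bdd P CP) (hR : Bdd R CR) (c a b κ r wg wgh : ℝ)
    (hunits₁ : r * wg = c * b) (hunits₂ : r * wg = κ * (c ^ 2 * a ^ 2)) (Nw : ℕ)
    {S V : Fin 4 → Site 4 → MKer 4 F} {Cs Cv δ : ℝ} (hS : ∀ κ u, BiLoc (S κ u) u u Cs δ) (hV : ∀ κ u, BiLoc (V κ u) u u Cv δ)
    {Wf W : Fin 4 → Site 4 → Fin 4 → Site 4 → MKer 4 F} {C2 Cw : ℝ}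
    (hWf : ∀ κ u l u', BiLoc (Wf κ u l u') u u' C2 δ) (hW : ∀ κ u l u', BiLoc (W κ u l u') u u' Cw δ) (hδ : 0 < δ)
    {Ftab Fmix Fgh FN G0 : EKer₂ 4} {Kc : Fin 4 → Fin 4 → Pt → ℝ}
    (hslice : ∀ c' e s s', Ftab c' e s s' =
      ((1 / 2 : ℝ) * tadpole (c • P + R) (Wf c' s e s') - (1 / 2 : ℝ) * κ * bubble (c • P + R) (S c' s) (S e s'))
        + Fmix c' e s s' + Fgh c' e s s' + FN c' e s s')
    (hPi : ∀ c' e s s', Kc c' e (s' - s) = wg * fineHessA P V W c' e s s' - wgh * G0 c' e s s')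
    {ιM : Type*} (JM : Finset ιM) {Gmix : ιM → EKer₂ 4}
    (hmix : ∀ c' e s s', (if supNorm (s' - s) ≤ Nw then Fmix c' e s s' else 0) = ∑ k ∈ JM, Gmix k c' e s s')
    {ιG : Type*} (JG : Finset ιG) {Ggh : ιG → EKer₂ 4}
    (hgh : ∀ c' e s s', (if supNorm (s' - s) ≤ Nw then Fgh c' e s s' + r * wgh * G0 c' e s s' else 0) = ∑ k ∈ JG, Ggh k c' e s s')
    (c' e : Fin 4) (s s' : Pt) :
    (if supNorm (s' - s) ≤ Nw then Ftab c' e s s' - r * Kc c' e (s' - s) else 0)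
      = ∑ j ∈ ((Finset.univ : Finset (Fin 7)).disjSum (JM.disjSum (JG.disjSum ({()} : Finset Unit)))),
          (Sum.elim
            (![(fun c' e s s' => if supNorm (s' - s) ≤ Nw then (1 / 2 : ℝ) * tadpole R (Wf c' s e s') else 0 : EKer₂ 4),
               (fun c' e s s' => if supNorm (s' - s) ≤ Nw then -((1 / 2 : ℝ) * κ) * tr (comp (comp (c • P) (S c' s)) (comp R (S e s'))) else 0),
               (fun c' e s s' => if supNorm (s' - s) ≤ Nw then -((1 / 2 : ℝ) * κ) * tr (comp (comp R (S c' s)) (comp (c • P) (S e s'))) else 0),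
               (fun c' e s s' => if supNorm (s' - s) ≤ Nw then -((1 / 2 : ℝ) * κ) * bubble R (S c' s) (S e s') else 0),
               (fun c' e s s' => if supNorm (s' - s) ≤ Nw then (1 / 2 : ℝ) * tadpole (c • P) (Wf c' s e s' - b • W c' s e s') else 0),
               (fun c' e s s' => if supNorm (s' - s) ≤ Nw then -((1 / 2 : ℝ) * κ) * bubble (c • P) (S c' s - a • V c' s) (S e s') else 0),
               (fun c' e s s' => if supNorm (s' - s) ≤ Nw then -((1 / 2 : ℝ) * κ) * bubble (c • P) (a • V c' s) (S e s' - a • V e s') else 0)])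
            (Sum.elim Gmix (Sum.elim Ggh (fun _ c' e s s' => if supNorm (s' - s) ≤ Nw then FN c' e s s' else 0))) : _ → EKer₂ 4)
            j c' e s s' := by
  rw [Finset.sum_disjSum, Finset.sum_disjSum, Finset.sum_disjSum, Finset.sum_singleton]
  simp only [Sum.elim_inl, Sum.elim_inr]
  rw [Fin.sum_univ_seven]
  simp only [Matrix.cons_val_zero, Matrix.cons_val_one, Matrix.cons_val]
  rw [← hmix c' e s s', ← hgh c' e s s',
    ← near_gluonCore_eq_seven hP hR c a b κ (r * wg) hunits₁ hunits₂ Nw hS hV hWf hW hδ c' e s s']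
  by_cases h : supNorm (s' - s) ≤ Nw
  · simp only [if_pos h]
    rw [hslice, hPi]
    ring
  · simp only [if_neg h]; ring

end NearSplit

end Summit.QuantumFields.BalabanUV.Beta.FP.FineHessianNearLedgerCore

end
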